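import Mathlib
import HarnessLib
import Summits.HubbardSuperconductivity.HubbardSuperconductivity.Theorems.KLProgrammeC4aUmkLoopCircleCanonicalFarSSplit
import Summits.HubbardSuperconductivity.HubbardSuperconductivity.Theorems.KLProgrammeC4aUmkNumerator
import Summits.HubbardSuperconductivity.HubbardSuperconductivity.Theorems.KLProgrammeC4aUmkCutoffDefs

/-!
# Route `KLProgramme` — crux C4a, S3 brick (B4) «(U1)-HYBRID» kernel × numerator, B-1 (vi)'s `hUmk` PRODUCED: the umklapp first-order `ϑ`-layer of the piece
# `A_s/Cᴬ` on the whole circle with the umklapp numerator's rows discharged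

Cell `gate-hubbard-kl`, seat hubbard-kl-k3c3-p1 (g19; row «δμ-flow with klAngularMean constant piece»).  Composition of three landed bricks: U7 with its kernel rows
discharged (`umkLoopCircle_integral_ppFarSSplit_le_canonical`, this seat g18), the umklapp numerator's rows (`…C4aUmkNumerator`, k3c3-p3 g36) and the cut-offs' rows (`…C4aUmkCutoffDefs`, k3c3-p3
g37).  **`umkFirstOrderLayer_ppFarSSplit_le_canonical`**: see the docstring.  Consumer: the `hUmk` binder of k3c3-p3's B-1 (vi) `firstOrderLayer_abs_le` / of this seat's
`firstOrderLayer_abs_ppFarSSplit_le`.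
Pure composition; nothing asserts (C), K3, the window or superconductivity.
References: BGM 2006 §2.4 (2.36) [cite: BenfattoGiulianiMastropietro2006]; FST II CPAM 51 (1998) §3 [cite: FeldmanSalmhoferTrubowitz1998].
-/

noncomputable section

namespace Summit.HubbardSuperconductivity.HubbardSuperconductivity.Theorems.C4a

set_option linter.dupNamespace false -- summit = problem name (single-conjunct summit), D-0017

open Real Set Filter MeasureTheory intervalIntegral
open scoped Topology
open Literature.MathematicalPhysics.QuantumLattice Literature.MathematicalPhysics.QuantumLattice.BandSectorCounting Literature.Probability.LatticeModels
open Literature.MathematicalPhysics.QuantumLattice.FermiRG Literature.Analysis.SpecialFunctions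
open Summit.HubbardSuperconductivity.HubbardSuperconductivity.Theorems.KLRegimeSplit
open Summit.HubbardSuperconductivity.HubbardSuperconductivity.Theorems.DispersionFlow
open Summit.HubbardSuperconductivity.HubbardSuperconductivity.Theorems.PerturbedFermiCurve

section Sizes

variable {K : TrigPolyC4v} {A : ℝ} (hA : ∀ p : Momentum, ∀ j ≤ 2, ‖iteratedFDeriv ℝ j (frameShift K) p‖ ≤ A) (hA20 : A ≤ 1 / 20)
  (hd : klCurveD ≤ (bandBounds (show (-4 : ℝ) < -1.1 by norm_num) (show (-1.1 : ℝ) ≤ -0.1 by norm_num)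
    (show (-0.1 : ℝ) < 0 by norm_num)).Dtmin - 2 * A)
  {μ r : ℝ} (hr : 0 < r) (hlo : (-1.1 : ℝ) < μ - r - A) (hhi : μ + r + A < -0.1)
  {A₃ A₄ : ℝ} (hA₃ : ∀ p : Momentum, ‖iteratedFDeriv ℝ 3 (frameShift K) p‖ ≤ A₃)
  (hA₄ : ∀ p : Momentum, ‖iteratedFDeriv ℝ 4 (frameShift K) p‖ ≤ A₄)
  {K₁ K₂ K₃ : ℝ} (hK₁ : ∀ p : Momentum, ‖fderiv ℝ (frameLevel μ K) p‖ ≤ K₁) (hK₂ : ∀ p : Momentum, ‖iteratedFDeriv ℝ 2 (frameLevel μ K) p‖ ≤ K₂)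
  (hK₃ : ∀ p : Momentum, ‖iteratedFDeriv ℝ 3 (frameLevel μ K) p‖ ≤ K₃)
include hA hA20 hd hr hlo hhi hA₃ hA₄ hK₁ hK₂ hK₃

set_option maxHeartbeats 400000 in
/-- **THE UMKLAPP FIRST-ORDER LAYER ON THE WHOLE `ϑ`-CIRCLE FOR `A_s/Cᴬ`, NUMERATOR DISCHARGED** (stmt-20437 (C), `M₁`): `umkLoopCircle_integral_ppFarSSplit_le_canonical` (U7 ∘ kernel rows)
at the umklapp numerator `Y := c_d·c_C·Jw·G` of `…C4aUmkNumerator` with the concrete cut-offs `c_d = umkDirCut μ K ρ θ τ₂`, `c_C = umkCooperCut μ K ρ θ s₂` of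
`…C4aUmkCutoffDefs` (null thresholds `τ₁ := τ₂/2`, `s₁ := s₂/2`), the `ϑ`-arcs `(0, 2π]` in `Nt` tiles (`α₀ := 0`, `ℓ := 2π/Nt`), the loop circle `[−π, π]`
(`v₀ := −π`); the eleven numerator rows are discharged (`Y₀ = J₀K₁·2msD₁`, `Y₁ = (24msD₁/τ₂)J₀K₁·2msD₁ + J₁K₁·2msD₁ + J₀K₂msD₁·2msD₁`,
`Y_L = J_L K₁·2msD₁ + J₀K₂·2msD₁/(Dt−2A)`).  What is left: U7's thresholds verbatim (with `ℓ = 2π/Nt`), the weight rows, and the SIX ROWS OF THE ABSTRACT JACOBIAN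
FACTOR `Jw` (`C¹`, `|Jw| ≤ J₀`, `|∂_vJw| ≤ J₁`, `2π`-periodic, jointly continuous, `e`-Lipschitz `J_L`).  The conclusion is LITERALLY the hypothesis `hUmk` of
`firstOrderLayer_abs_ppFarSSplit_le` (B-1 (vi) ∘ kernel rows). [cite: BenfattoGiulianiMastropietro2006, §2.4 (2.36)] [cite: FeldmanSalmhoferTrubowitz1998, §3] -/
theorem umkFirstOrderLayer_ppFarSSplit_le_canonical
    {R : RenConsts} {U : ℝ} {N : ℕ} (hF : FrameOK R U N μ K) {Kc r₀ g₀ w : ℝ} (hG : GeomConstants (frameLevel μ K) Kc r₀ g₀ w) {ρ : ℝ} (hρ : |ρ| < r)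
    (hρ₀ : |ρ| < 3 / 80) (θ : ℝ) {Nt J : ℕ} (hJ : 2 ≤ J) {τ₀ lo hi Wφ Wm qs Δ K₀ W Afl Bfl Mρ Γ Γ' η₀ Δc ω d₁ lam eps κ₀ s₀ : ℝ}
    {Jw : ℝ → ℝ → ℝ} {J₀ J₁ JL τ₂ s₂ : ℝ} {wt : ℝ → ℝ} {βT Λ B₁ B₂ B₃ : ℝ} (hkβ : 0 < βT) (hkΛ : 0 < Λ) (hkB₁ : ∀ x, |deriv salmhoferCutoff x| ≤ B₁)
    (hkB₂ : ∀ x, |deriv (deriv salmhoferCutoff) x| ≤ B₂) (hkB₃ : ∀ x, |deriv (deriv (deriv salmhoferCutoff)) x| ≤ B₃) {t₁ : ℝ} (hkt₀ : 0 < t₁)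
    (hkt25 : t₁ ≤ 2 / 5) (hkloΛ : lo ≤ Λ) {W' : ℝ} (hW' : 0 ≤ W') (hwL : ∀ e ∈ Icc lo hi, |wt e - wt lo| ≤ W' * (e - lo)) (hWm : 0 ≤ Wm)
    (hMρ : (32 * (1 * (64 * B₂ + 120 * B₁ + 154) + (6 / t₁) * (12 * B₁ + 9)) * (Λ / lo) ^ 3 +
          32 * (1 * ((βT * lo) ^ 2 + 2) + (6 / t₁) * (βT * lo + 1)) / (βT * lo) ^ 3) / (1 * (12 * B₁ + 9) +
      (1 * (64 * B₂ + 108 * B₁ + 145) + (6 / t₁) * (12 * B₁ + 9)) +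
      (1 * (256 * B₃ + 800 * B₂ + 2592 * B₁ + 1630) + 2 * (6 / t₁) * (64 * B₂ + 108 * B₁ + 145) + (12 * B₁ + 9) * ((8388608 / t₁ ^ 2) + 3 * (6 / t₁))) +
      (1 * (128 * B₁ + 72) + 8 * (6 / t₁))) ≤ Mρ)
    (hmod : K₃ * (τ₀ + msD A₃ A₄ 1 * ((2 * π / Nt)) +
              hi / ((bandBounds (show (-4 : ℝ) < -1.1 by norm_num) (show (-1.1 : ℝ) ≤ -0.1 by norm_num) (show (-0.1 : ℝ) < 0 by norm_num)).Dtmin - 2 * A) +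
              msD A₃ A₄ 1 * Wφ) * msD A₃ A₄ 1 ^ 2 +
          K₂ * (radialRowOneConst A ((bandBounds (show (-4 : ℝ) < -1.1 by norm_num) (show (-1.1 : ℝ) ≤ -0.1 by norm_num) (show (-0.1 : ℝ) < 0 by norm_num)).Dtmin -
                2 * A) * hi + msD A₃ A₄ 2 * Wφ) * (msD A₃ A₄ 1 + msD A₃ A₄ 1) +
          K₂ * (τ₀ + msD A₃ A₄ 1 * ((2 * π / Nt)) +
              hi / ((bandBounds (show (-4 : ℝ) < -1.1 by norm_num) (show (-1.1 : ℝ) ≤ -0.1 by norm_num) (show (-0.1 : ℝ) < 0 by norm_num)).Dtmin - 2 * A) +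
              msD A₃ A₄ 1 * Wφ) * msD A₃ A₄ 2 +
          K₁ * ((uRowTwoConst A A₃ ((bandBounds (show (-4 : ℝ) < -1.1 by norm_num) (show (-1.1 : ℝ) ≤ -0.1 by norm_num) (show (-0.1 : ℝ) < 0 by norm_num)).Dtmin -
                  2 * A) +
                1 / ((bandBounds (show (-4 : ℝ) < -1.1 by norm_num) (show (-1.1 : ℝ) ≤ -0.1 by norm_num) (show (-0.1 : ℝ) < 0 by norm_num)).Dtmin - 2 * A) +
                2 * (radialRowOneConst A ((bandBounds (show (-4 : ℝ) < -1.1 by norm_num) (show (-1.1 : ℝ) ≤ -0.1 by norm_num)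
                    (show (-0.1 : ℝ) < 0 by norm_num)).Dtmin - 2 * A) -
                  1 / ((bandBounds (show (-4 : ℝ) < -1.1 by norm_num) (show (-1.1 : ℝ) ≤ -0.1 by norm_num) (show (-0.1 : ℝ) < 0 by norm_num)).Dtmin - 2 * A))) *
              hi + msD A₃ A₄ 3 * Wφ) ≤
        w * (bandBounds (show (-4 : ℝ) < -1.1 by norm_num) (show (-1.1 : ℝ) ≤ -0.1 by norm_num) (show (-0.1 : ℝ) < 0 by norm_num)).umin ^ 2)
    (hsl : K₂ * msD A₃ A₄ 1 * (τ₀ + msD A₃ A₄ 1 * ((2 * π / Nt)) +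
        2 * (hi / ((bandBounds (show (-4 : ℝ) < -1.1 by norm_num) (show (-1.1 : ℝ) ≤ -0.1 by norm_num) (show (-0.1 : ℝ) < 0 by norm_num)).Dtmin - 2 * A))) ≤
      w * (bandBounds (show (-4 : ℝ) < -1.1 by norm_num) (show (-1.1 : ℝ) ≤ -0.1 by norm_num) (show (-0.1 : ℝ) < 0 by norm_num)).umin ^ 2 * Wm)
    (hrt : K₂ * (τ₀ + msD A₃ A₄ 1 * ((2 * π / Nt)) +
          2 * (hi / ((bandBounds (show (-4 : ℝ) < -1.1 by norm_num) (show (-1.1 : ℝ) ≤ -0.1 by norm_num) (show (-0.1 : ℝ) < 0 by norm_num)).Dtmin - 2 * A) +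
            msD A₃ A₄ 1 * Wφ)) /
        ((bandBounds (show (-4 : ℝ) < -1.1 by norm_num) (show (-1.1 : ℝ) ≤ -0.1 by norm_num) (show (-0.1 : ℝ) < 0 by norm_num)).Dtmin - 2 * A) ≤ 1 / 2)
    (hlo0 : 0 < lo) (hlohi : lo ≤ hi) (hhir : hi < r) (hqs : 3 / 2 ≤ qs) (hqs' : qs ≤ (1 - t₁) / t₁) (hW : 0 ≤ W)
    (hAfl : W * (4 * (1 * (64 * B₂ + 108 * B₁ + 145) + (6 / t₁) * (12 * B₁ + 9)) * (Λ / lo) ^ 2 +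
            (1 * ((6 * B₁ + 5 / 2) * (Λ / lo) + Λ / lo / (2 * (1 - t₁)) + 6 / (βT * lo) + 1) + (6 / t₁) * (1 / (2 * (1 - t₁)) + t₁ / (1 - t₁)))) / (1 * (12 * B₁ + 9) +
      (1 * (64 * B₂ + 108 * B₁ + 145) + (6 / t₁) * (12 * B₁ + 9)) +
      (1 * (256 * B₃ + 800 * B₂ + 2592 * B₁ + 1630) + 2 * (6 / t₁) * (64 * B₂ + 108 * B₁ + 145) + (12 * B₁ + 9) * ((8388608 / t₁ ^ 2) + 3 * (6 / t₁))) +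
      (1 * (128 * B₁ + 72) + 8 * (6 / t₁))) ≤ Afl)
    (hBfl : W' * (1 * (64 * B₂ + 108 * B₁ + 145) + (6 / t₁) * (12 * B₁ + 9)) * t₁ ^ 2 / (1 - t₁) ^ 2 / (1 * (12 * B₁ + 9) +
      (1 * (64 * B₂ + 108 * B₁ + 145) + (6 / t₁) * (12 * B₁ + 9)) +
      (1 * (256 * B₃ + 800 * B₂ + 2592 * B₁ + 1630) + 2 * (6 / t₁) * (64 * B₂ + 108 * B₁ + 145) + (12 * B₁ + 9) * ((8388608 / t₁ ^ 2) + 3 * (6 / t₁))) +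
      (1 * (128 * B₁ + 72) + 8 * (6 / t₁))) ≤ Bfl)
    (hK₀ : ∀ p : Momentum, |frameLevel μ K p| ≤ K₀) (hK₀pos : 0 < K₀) (hΓ₁ : K₀ ≤ Γ) (hΓ₂ : hi / 2 ≤ Γ) (hΓ'₁ : K₀ ≤ Γ')
    (hΔ : τ₀ + msD A₃ A₄ 1 * ((2 * π / Nt)) + 2 * (msD A₃ A₄ 1 * Wφ) ≤ Δ) (hΔ1 : Δ ≤ 3 / 10)
    (hΔu : Δ ≤ (bandBounds (show (-4 : ℝ) < -1.1 by norm_num) (show (-1.1 : ℝ) ≤ -0.1 by norm_num) (show (-0.1 : ℝ) < 0 by norm_num)).umin)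
    (hΔr : K₁ * Δ < r) (hDfl : K₁ * Δ ≤ hi / t₁) (hwc : ContinuousOn wt (Icc (-hi) hi)) (hw0 : ∀ e ∈ Icc (-hi) hi, 0 ≤ wt e)
    (hwW : ∀ e ∈ Icc (-hi) hi, wt e ≤ W)
    (hsame : τ₀ + 2 * (msD A₃ A₄ 1 * η₀ + |ρ| / ((bandBounds (show (-4 : ℝ) < -1.1 by norm_num) (show (-1.1 : ℝ) ≤ -0.1 by norm_num) (show (-0.1 : ℝ) < 0 by norm_num)).Dtmin - 2 * A)) ≤ 3 / 5)
    (hΔc1 : Δc ≤ 3 / 10) (hΔcr : K₁ * Δc < r) (hω₁ : η₀ + ((2 * π / Nt)) ≤ ω)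
    (hΓ : 2 / π * (((bandBounds (show (-4 : ℝ) < -1.1 by norm_num) (show (-1.1 : ℝ) ≤ -0.1 by norm_num) (show (-0.1 : ℝ) < 0 by norm_num)).Dtmin - 2 * A) * (bandBounds (show (-4 : ℝ) < -1.1 by norm_num) (show (-1.1 : ℝ) ≤ -0.1 by norm_num) (show (-0.1 : ℝ) < 0 by norm_num)).umin) *
      ((bandBounds (show (-4 : ℝ) < -1.1 by norm_num) (show (-1.1 : ℝ) ≤ -0.1 by norm_num) (show (-0.1 : ℝ) < 0 by norm_num)).umin * (3 / 200) / (4 + 2 * A) * (η₀ - ((2 * π / Nt)) - π / (2 * (bandBounds (show (-4 : ℝ) < -1.1 by norm_num) (show (-1.1 : ℝ) ≤ -0.1 by norm_num) (show (-0.1 : ℝ) < 0 by norm_num)).umin) * Δc) - π * 7 * (K₁ * Δc + |ρ|) / ((bandBounds (show (-4 : ℝ) < -1.1 by norm_num) (show (-1.1 : ℝ) ≤ -0.1 by norm_num) (show (-0.1 : ℝ) < 0 by norm_num)).Dtmin - 2 * A) ^ 2) * ((2 * π / Nt)) ≤ Γ)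
    (hhir₀ : hi < r₀) (hhiK : hi ≤ K₀) (hd₁ : 0 < d₁) (hlam : 0 < lam)
    (hhid : K₁ * (hi / ((bandBounds (show (-4 : ℝ) < -1.1 by norm_num) (show (-1.1 : ℝ) ≤ -0.1 by norm_num) (show (-0.1 : ℝ) < 0 by norm_num)).Dtmin - 2 * A)) ≤ d₁ / 2)
    (hepsr : eps ≤ r) (hT : KlwjCertB)
    (hτ₀ : msD A₃ A₄ 1 *
            ((π / 2 * lam /
                  (((bandBounds (show (-4 : ℝ) < -1.1 by norm_num) (show (-1.1 : ℝ) ≤ -0.1 by norm_num) (show (-0.1 : ℝ) < 0 by norm_num)).Dtmin -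
                      2 * A) *
                    (bandBounds (show (-4 : ℝ) < -1.1 by norm_num) (show (-1.1 : ℝ) ≤ -0.1 by norm_num) (show (-0.1 : ℝ) < 0 by norm_num)).umin) +
                π * Kc * eps / ((bandBounds (show (-4 : ℝ) < -1.1 by norm_num) (show (-1.1 : ℝ) ≤ -0.1 by norm_num) (show (-0.1 : ℝ) < 0 by norm_num)).Dtmin - 2 * A) ^ 2) /
              ((bandBounds (show (-4 : ℝ) < -1.1 by norm_num) (show (-1.1 : ℝ) ≤ -0.1 by norm_num) (show (-0.1 : ℝ) < 0 by norm_num)).umin * w /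
                (4 + 2 * A))) +
          (2 * hi + eps) / ((bandBounds (show (-4 : ℝ) < -1.1 by norm_num) (show (-1.1 : ℝ) ≤ -0.1 by norm_num) (show (-0.1 : ℝ) < 0 by norm_num)).Dtmin -
            2 * A) ≤ τ₀)
    (hκ₀ : 0 < κ₀)
    (hκ₀le : κ₀ ≤ 2 / π * (((bandBounds (show (-4 : ℝ) < -1.1 by norm_num) (show (-1.1 : ℝ) ≤ -0.1 by norm_num) (show (-0.1 : ℝ) < 0 by norm_num)).Dtmin - 2 * A) * (bandBounds (show (-4 : ℝ) < -1.1 by norm_num) (show (-1.1 : ℝ) ≤ -0.1 by norm_num) (show (-0.1 : ℝ) < 0 by norm_num)).umin) *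
      ((bandBounds (show (-4 : ℝ) < -1.1 by norm_num) (show (-1.1 : ℝ) ≤ -0.1 by norm_num) (show (-0.1 : ℝ) < 0 by norm_num)).umin * (3 / 200) / (4 + 2 * A) * (η₀ - ((2 * π / Nt)) - π / (2 * (bandBounds (show (-4 : ℝ) < -1.1 by norm_num) (show (-1.1 : ℝ) ≤ -0.1 by norm_num) (show (-0.1 : ℝ) < 0 by norm_num)).umin) * Δc) - π * 7 * (K₁ * Δc + |ρ|) / ((bandBounds (show (-4 : ℝ) < -1.1 by norm_num) (show (-1.1 : ℝ) ≤ -0.1 by norm_num) (show (-0.1 : ℝ) < 0 by norm_num)).Dtmin - 2 * A) ^ 2))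
    (hs₀ : 0 < s₀)
    (hs₀le : s₀ ≤ 9 / 400 * (bandBounds (show (-4 : ℝ) < -1.1 by norm_num) (show (-1.1 : ℝ) ≤ -0.1 by norm_num) (show (-0.1 : ℝ) < 0 by norm_num)).umin ^ 2 - 2 * (2 * K₃ * Δc * msD A₃ A₄ 1 ^ 2 +
        4 * K₂ * (radialRowOneConst A ((bandBounds (show (-4 : ℝ) < -1.1 by norm_num) (show (-1.1 : ℝ) ≤ -0.1 by norm_num) (show (-0.1 : ℝ) < 0 by norm_num)).Dtmin - 2 * A) * |ρ| + msD A₃ A₄ 2 * ω) * msD A₃ A₄ 1 +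
        K₂ * Δc * msD A₃ A₄ 2 +
        K₁ * ((uRowTwoConst A A₃ ((bandBounds (show (-4 : ℝ) < -1.1 by norm_num) (show (-1.1 : ℝ) ≤ -0.1 by norm_num) (show (-0.1 : ℝ) < 0 by norm_num)).Dtmin - 2 * A) + 1 / ((bandBounds (show (-4 : ℝ) < -1.1 by norm_num) (show (-1.1 : ℝ) ≤ -0.1 by norm_num) (show (-0.1 : ℝ) < 0 by norm_num)).Dtmin - 2 * A) +
              2 * (radialRowOneConst A ((bandBounds (show (-4 : ℝ) < -1.1 by norm_num) (show (-1.1 : ℝ) ≤ -0.1 by norm_num) (show (-0.1 : ℝ) < 0 by norm_num)).Dtmin - 2 * A) - 1 / ((bandBounds (show (-4 : ℝ) < -1.1 by norm_num) (show (-1.1 : ℝ) ≤ -0.1 by norm_num) (show (-0.1 : ℝ) < 0 by norm_num)).Dtmin - 2 * A))) * |ρ| + msD A₃ A₄ 3 * ω)))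
    (hτ₁ : τ₀ + msD A₃ A₄ 1 * ((2 * π / Nt) + 2 * (4 * (2 * π / J))) ≤ (τ₂ / 2))
    (hs₁ : msD A₃ A₄ 1 *
            ((π / 2 * lam /
                  (((bandBounds (show (-4 : ℝ) < -1.1 by norm_num) (show (-1.1 : ℝ) ≤ -0.1 by norm_num) (show (-0.1 : ℝ) < 0 by norm_num)).Dtmin -
                      2 * A) *
                    (bandBounds (show (-4 : ℝ) < -1.1 by norm_num) (show (-1.1 : ℝ) ≤ -0.1 by norm_num) (show (-0.1 : ℝ) < 0 by norm_num)).umin) +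
                π * Kc * eps / ((bandBounds (show (-4 : ℝ) < -1.1 by norm_num) (show (-1.1 : ℝ) ≤ -0.1 by norm_num) (show (-0.1 : ℝ) < 0 by norm_num)).Dtmin - 2 * A) ^ 2) /
              ((bandBounds (show (-4 : ℝ) < -1.1 by norm_num) (show (-1.1 : ℝ) ≤ -0.1 by norm_num) (show (-0.1 : ℝ) < 0 by norm_num)).umin * w /
                (4 + 2 * A))) +
          eps / ((bandBounds (show (-4 : ℝ) < -1.1 by norm_num) (show (-1.1 : ℝ) ≤ -0.1 by norm_num) (show (-0.1 : ℝ) < 0 by norm_num)).Dtmin - 2 * A) + msD A₃ A₄ 1 * (2 * π / Nt) ≤ (s₂ / 2))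
    (hWφ : (4 * (2 * π / J)) + 2 * Wm ≤ Wφ)
    (hΓ'₂ : w * (bandBounds (show (-4 : ℝ) < -1.1 by norm_num) (show (-1.1 : ℝ) ≤ -0.1 by norm_num) (show (-0.1 : ℝ) < 0 by norm_num)).umin ^ 2 / 2 * ((4 * (2 * π / J)) + 2 * Wm) ^ 2 ≤ Γ')
    (hΔc : τ₀ + msD A₃ A₄ 1 * (((2 * π / Nt)) + ((4 * (2 * π / J)) + 2 * Wm)) ≤ Δc) (hω₂ : (4 * (2 * π / J)) + 2 * Wm ≤ ω)
    (heps : d₁ + K₁ * (msD A₃ A₄ 1 * ((4 * (2 * π / J)))) + K₁ * (hi / ((bandBounds (show (-4 : ℝ) < -1.1 by norm_num) (show (-1.1 : ℝ) ≤ -0.1 by norm_num) (show (-0.1 : ℝ) < 0 by norm_num)).Dtmin - 2 * A)) + hi ≤ eps)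
    (hNt : 0 < Nt) (hτ₂ : 0 < τ₂) (hs₂ : 0 < s₂) (hJ₀ : 0 ≤ J₀) (hJ₁ : 0 ≤ J₁) (hJL : 0 ≤ JL)
    (hJwd : ∀ e ∈ Icc (-hi) hi, ContDiff ℝ 1 (Jw e)) (hJwb : ∀ e ∈ Icc (-hi) hi, ∀ v, |Jw e v| ≤ J₀) (hJw1 : ∀ e ∈ Icc (-hi) hi, ∀ v, |deriv (Jw e) v| ≤ J₁)
    (hJwper : ∀ e ∈ Icc (-hi) hi, ∀ v, Jw e (v + 2 * π) = Jw e v) (hJw2 : ContinuousOn (fun q : ℝ × ℝ => Jw q.1 q.2) (Icc (-hi) hi ×ˢ univ))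
    (hJwL : ∀ e ∈ Icc lo hi, ∀ v, |Jw e v - Jw lo v| ≤ JL * |e - lo|) :
   
    ∫ ϑ in (0 : ℝ)..(2 * π), |∫ e in (-hi)..hi, ∫ v in (-π)..π, wt e * (umkDirCut μ K ρ θ τ₂ ϑ v * umkCooperCut μ K ρ θ s₂ ϑ * Jw e v * ((fderiv ℝ (frameLevel μ K) (pairSumPath μ K ρ ϑ θ 0 - levelPoint μ K e (v + θ))) (iteratedDeriv 1 (levelPoint μ K 0) θ + iteratedDeriv 1 (levelPoint μ K ρ) (ϑ + θ))) * deriv (fun v : ℝ => ppFarKernelS βT Λ (ppSplitProfile t₁) lo e v / (1 * (12 * B₁ + 9) +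
      (1 * (64 * B₂ + 108 * B₁ + 145) + (6 / t₁) * (12 * B₁ + 9)) +
      (1 * (256 * B₃ + 800 * B₂ + 2592 * B₁ + 1630) + 2 * (6 / t₁) * (64 * B₂ + 108 * B₁ + 145) + (12 * B₁ + 9) * ((8388608 / t₁ ^ 2) + 3 * (6 / t₁))) +
      (1 * (128 * B₁ + 72) + 8 * (6 / t₁)))) (frameLevel μ K (pairSumPath μ K ρ ϑ θ 0 - levelPoint μ K e (v + θ))))| ≤ (J : ℝ) * ((Nt : ℝ) * max (max (2 * ((2 * (      3 * W * ((4 + 2 * (3 / 2 : ℝ) + 1 / 2) / (1 / 2)) *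
          ((J₀ * (K₁ * (2 * msD A₃ A₄ 1))) * (4 / Real.sqrt (2 * (K₂ * msD A₃ A₄ 1 ^ 2) +
                    w * (bandBounds (show (-4 : ℝ) < -1.1 by norm_num) (show (-1.1 : ℝ) ≤ -0.1 by norm_num) (show (-0.1 : ℝ) < 0 by norm_num)).umin ^ 2) +
                  16 * Real.sqrt (2 * (K₂ * msD A₃ A₄ 1 ^ 2) +
                        w * (bandBounds (show (-4 : ℝ) < -1.1 by norm_num) (show (-1.1 : ℝ) ≤ -0.1 by norm_num) (show (-0.1 : ℝ) < 0 by norm_num)).umin ^ 2) /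
                      (w * (bandBounds (show (-4 : ℝ) < -1.1 by norm_num) (show (-1.1 : ℝ) ≤ -0.1 by norm_num) (show (-0.1 : ℝ) < 0 by norm_num)).umin ^ 2) +
                  64 * (2 * (K₂ * msD A₃ A₄ 1 ^ 2) +
                          w * (bandBounds (show (-4 : ℝ) < -1.1 by norm_num) (show (-1.1 : ℝ) ≤ -0.1 by norm_num) (show (-0.1 : ℝ) < 0 by norm_num)).umin ^ 2) ^ 2 *
                      Real.sqrt (2 * (K₂ * msD A₃ A₄ 1 ^ 2) +
                          w * (bandBounds (show (-4 : ℝ) < -1.1 by norm_num) (show (-1.1 : ℝ) ≤ -0.1 by norm_num) (show (-0.1 : ℝ) < 0 by norm_num)).umin ^ 2) /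
                    (w * (bandBounds (show (-4 : ℝ) < -1.1 by norm_num) (show (-1.1 : ℝ) ≤ -0.1 by norm_num) (show (-0.1 : ℝ) < 0 by norm_num)).umin ^ 2) ^ 3) *
              Real.sqrt (4 + 2 * (3 / 2 : ℝ) + 1 / 2) +
            32 * ((24 * msD A₃ A₄ 1 / τ₂ * J₀ * (K₁ * (2 * msD A₃ A₄ 1)) + J₁ * (K₁ * (2 * msD A₃ A₄ 1)) + J₀ * (K₂ * msD A₃ A₄ 1 * (2 * msD A₃ A₄ 1))) + (J₀ * (K₁ * (2 * msD A₃ A₄ 1))) * (6 / (2 * π / J))) * (2 * (K₂ * msD A₃ A₄ 1 ^ 2) +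
                  w * (bandBounds (show (-4 : ℝ) < -1.1 by norm_num) (show (-1.1 : ℝ) ≤ -0.1 by norm_num) (show (-0.1 : ℝ) < 0 by norm_num)).umin ^ 2) /
              (w * (bandBounds (show (-4 : ℝ) < -1.1 by norm_num) (show (-1.1 : ℝ) ≤ -0.1 by norm_num) (show (-0.1 : ℝ) < 0 by norm_num)).umin ^ 2) ^ 2))) * max 1 (Real.sqrt (κ₀))⁻¹ * (81 * (Γ / (κ₀)) ^ (1 / 4 : ℝ)) *
          (((2 * π / Nt)) ^ (3 / 4 : ℝ) / (3 / 4) + ((2 * π / Nt)) ^ (1 / 4 : ℝ) / (1 / 4))))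
      ((8 * (32 * ((J₀ * (K₁ * (2 * msD A₃ A₄ 1))) * Afl + 5 * (W * (J₀ * (K₁ * (2 * msD A₃ A₄ 1))) * Mρ) + 32 * (W * (J₀ * (K₁ * (2 * msD A₃ A₄ 1))))) / (3 * Real.sqrt (w * (bandBounds (show (-4 : ℝ) < -1.1 by norm_num) (show (-1.1 : ℝ) ≤ -0.1 by norm_num) (show (-0.1 : ℝ) < 0 by norm_num)).umin ^ 2 / 2))) + 4 * (2 * (      W * ((J₀ * (K₁ * (2 * msD A₃ A₄ 1))) * (4 / Real.sqrt (2 * (K₂ * msD A₃ A₄ 1 ^ 2) +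
                    w * (bandBounds (show (-4 : ℝ) < -1.1 by norm_num) (show (-1.1 : ℝ) ≤ -0.1 by norm_num) (show (-0.1 : ℝ) < 0 by norm_num)).umin ^ 2) + 16 * Real.sqrt (2 * (K₂ * msD A₃ A₄ 1 ^ 2) +
                    w * (bandBounds (show (-4 : ℝ) < -1.1 by norm_num) (show (-1.1 : ℝ) ≤ -0.1 by norm_num) (show (-0.1 : ℝ) < 0 by norm_num)).umin ^ 2) / (w * (bandBounds (show (-4 : ℝ) < -1.1 by norm_num) (show (-1.1 : ℝ) ≤ -0.1 by norm_num) (show (-0.1 : ℝ) < 0 by norm_num)).umin ^ 2) + 64 * (2 * (K₂ * msD A₃ A₄ 1 ^ 2) +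
                    w * (bandBounds (show (-4 : ℝ) < -1.1 by norm_num) (show (-1.1 : ℝ) ≤ -0.1 by norm_num) (show (-0.1 : ℝ) < 0 by norm_num)).umin ^ 2) ^ 2 * Real.sqrt (2 * (K₂ * msD A₃ A₄ 1 ^ 2) +
                    w * (bandBounds (show (-4 : ℝ) < -1.1 by norm_num) (show (-1.1 : ℝ) ≤ -0.1 by norm_num) (show (-0.1 : ℝ) < 0 by norm_num)).umin ^ 2) / (w * (bandBounds (show (-4 : ℝ) < -1.1 by norm_num) (show (-1.1 : ℝ) ≤ -0.1 by norm_num) (show (-0.1 : ℝ) < 0 by norm_num)).umin ^ 2) ^ 3 +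
              2 * Real.sqrt (w * (bandBounds (show (-4 : ℝ) < -1.1 by norm_num) (show (-1.1 : ℝ) ≤ -0.1 by norm_num) (show (-0.1 : ℝ) < 0 by norm_num)).umin ^ 2) / (w * (bandBounds (show (-4 : ℝ) < -1.1 by norm_num) (show (-1.1 : ℝ) ≤ -0.1 by norm_num) (show (-0.1 : ℝ) < 0 by norm_num)).umin ^ 2) + (2 * (K₂ * msD A₃ A₄ 1 ^ 2) +
                    w * (bandBounds (show (-4 : ℝ) < -1.1 by norm_num) (show (-1.1 : ℝ) ≤ -0.1 by norm_num) (show (-0.1 : ℝ) < 0 by norm_num)).umin ^ 2) * Real.sqrt (w * (bandBounds (show (-4 : ℝ) < -1.1 by norm_num) (show (-1.1 : ℝ) ≤ -0.1 by norm_num) (show (-0.1 : ℝ) < 0 by norm_num)).umin ^ 2) / (w * (bandBounds (show (-4 : ℝ) < -1.1 by norm_num) (show (-1.1 : ℝ) ≤ -0.1 by norm_num) (show (-0.1 : ℝ) < 0 by norm_num)).umin ^ 2) ^ 2) +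
            ((24 * msD A₃ A₄ 1 / τ₂ * J₀ * (K₁ * (2 * msD A₃ A₄ 1)) + J₁ * (K₁ * (2 * msD A₃ A₄ 1)) + J₀ * (K₂ * msD A₃ A₄ 1 * (2 * msD A₃ A₄ 1))) + (J₀ * (K₁ * (2 * msD A₃ A₄ 1))) * (6 / (2 * π / J))) * (32 * (2 * (K₂ * msD A₃ A₄ 1 ^ 2) +
                    w * (bandBounds (show (-4 : ℝ) < -1.1 by norm_num) (show (-1.1 : ℝ) ≤ -0.1 by norm_num) (show (-0.1 : ℝ) < 0 by norm_num)).umin ^ 2) * Real.sqrt (K₀ + hi) / (w * (bandBounds (show (-4 : ℝ) < -1.1 by norm_num) (show (-1.1 : ℝ) ≤ -0.1 by norm_num) (show (-0.1 : ℝ) < 0 by norm_num)).umin ^ 2) ^ 2 + ((4 * (2 * π / J)) + 2 * Wm) * Real.sqrt (w * (bandBounds (show (-4 : ℝ) < -1.1 by norm_num) (show (-1.1 : ℝ) ≤ -0.1 by norm_num) (show (-0.1 : ℝ) < 0 by norm_num)).umin ^ 2) / (w * (bandBounds (show (-4 : ℝ) < -1.1 by norm_num) (show (-1.1 : ℝ)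 ≤ -0.1 by norm_num) (show (-0.1 : ℝ) < 0 by norm_num)).umin ^ 2))) *
          ((4 + 2 * (3 / 2 : ℝ) + 1 / 2) * Real.sqrt (4 + 2 * (3 / 2 : ℝ) + 1 / 2) *
                ((1 + Real.log 2 + log⁺ ((1 + 4 * (2 * (K₂ * msD A₃ A₄ 1 ^ 2) +
                    w * (bandBounds (show (-4 : ℝ) < -1.1 by norm_num) (show (-1.1 : ℝ) ≤ -0.1 by norm_num) (show (-0.1 : ℝ) < 0 by norm_num)).umin ^ 2) / (w * (bandBounds (show (-4 : ℝ) < -1.1 by norm_num) (show (-1.1 : ℝ) ≤ -0.1 by norm_num) (show (-0.1 : ℝ) < 0 by norm_num)).umin ^ 2)) * (1 + (3 / 2 : ℝ))) + log⁺ (1 + 4 * (2 * (K₂ * msD A₃ A₄ 1 ^ 2) +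
                    w * (bandBounds (show (-4 : ℝ) < -1.1 by norm_num) (show (-1.1 : ℝ) ≤ -0.1 by norm_num) (show (-0.1 : ℝ) < 0 by norm_num)).umin ^ 2) / (w * (bandBounds (show (-4 : ℝ) < -1.1 by norm_num) (show (-1.1 : ℝ) ≤ -0.1 by norm_num) (show (-0.1 : ℝ) < 0 by norm_num)).umin ^ 2))) + 4) +
            2 * (1 + Real.log 2 + log⁺ ((1 + 4 * (2 * (K₂ * msD A₃ A₄ 1 ^ 2) +
                    w * (bandBounds (show (-4 : ℝ) < -1.1 by norm_num) (show (-1.1 : ℝ) ≤ -0.1 by norm_num) (show (-0.1 : ℝ) < 0 by norm_num)).umin ^ 2) / (w * (bandBounds (show (-4 : ℝ) < -1.1 by norm_num) (show (-1.1 : ℝ) ≤ -0.1 by norm_num) (show (-0.1 : ℝ) < 0 by norm_num)).umin ^ 2)) * (1 + (3 / 2 : ℝ))) + log⁺ (1 + 4 * (2 * (K₂ * msD A₃ A₄ 1 ^ 2) +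
                    w * (bandBounds (show (-4 : ℝ) < -1.1 by norm_num) (show (-1.1 : ℝ) ≤ -0.1 by norm_num) (show (-0.1 : ℝ) < 0 by norm_num)).umin ^ 2) / (w * (bandBounds (show (-4 : ℝ) < -1.1 by norm_num) (show (-1.1 : ℝ) ≤ -0.1 by norm_num) (show (-0.1 : ℝ) < 0 by norm_num)).umin ^ 2))) *
              ((4 + 2 * (3 / 2 : ℝ) + 1 / 2) / (1 / 2) * Real.sqrt ((4 + 2 * (3 / 2 : ℝ) + 1 / 2) / (1 / 2))))))) / Real.sqrt ((s₀) / 2) + (((64 * W * (1 / (qs + 1 / 2)) ^ 2 * (J₀ * (K₁ * (2 * msD A₃ A₄ 1))) *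
                (K₂ / ((bandBounds (show (-4 : ℝ) < -1.1 by norm_num) (show (-1.1 : ℝ) ≤ -0.1 by norm_num) (show (-0.1 : ℝ) < 0 by norm_num)).Dtmin - 2 * A)) *
              ((1 / ((bandBounds (show (-4 : ℝ) < -1.1 by norm_num) (show (-1.1 : ℝ) ≤ -0.1 by norm_num) (show (-0.1 : ℝ) < 0 by norm_num)).Dtmin - 2 * A) +
                  msD A₃ A₄ 1 * (π * (4 + 2 * A) * Kc /
                    ((bandBounds (show (-4 : ℝ) < -1.1 by norm_num) (show (-1.1 : ℝ) ≤ -0.1 by norm_num) (show (-0.1 : ℝ) < 0 by norm_num)).umin * w *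
                      ((bandBounds (show (-4 : ℝ) < -1.1 by norm_num) (show (-1.1 : ℝ) ≤ -0.1 by norm_num) (show (-0.1 : ℝ) < 0 by norm_num)).Dtmin - 2 * A) ^ 2))) +
                2 * (1 / (qs + 1 / 2)) /
                  ((bandBounds (show (-4 : ℝ) < -1.1 by norm_num) (show (-1.1 : ℝ) ≤ -0.1 by norm_num) (show (-0.1 : ℝ) < 0 by norm_num)).Dtmin - 2 * A)) +
            4 * W * (1 / (qs + 1 / 2)) ^ 2 * (JL * (K₁ * (2 * msD A₃ A₄ 1)) + J₀ * (K₂ * (2 * msD A₃ A₄ 1) / ((bandBounds (show (-4 : ℝ) < -1.1 by norm_num) (show (-1.1 : ℝ) ≤ -0.1 by norm_num) (show (-0.1 : ℝ) < 0 by norm_num)).Dtmin - 2 * A))) + (J₀ * (K₁ * (2 * msD A₃ A₄ 1))) * Bfl) * ((4 * (2 * π / J)) + 2 * Wm) +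
          8 * (128 * W * (1 / (qs + 1 / 2)) ^ 2 * (J₀ * (K₁ * (2 * msD A₃ A₄ 1))) *
                (K₂ / ((bandBounds (show (-4 : ℝ) < -1.1 by norm_num) (show (-1.1 : ℝ) ≤ -0.1 by norm_num) (show (-0.1 : ℝ) < 0 by norm_num)).Dtmin - 2 * A)) *
              msD A₃ A₄ 1) /
            (w * (bandBounds (show (-4 : ℝ) < -1.1 by norm_num) (show (-1.1 : ℝ) ≤ -0.1 by norm_num) (show (-0.1 : ℝ) < 0 by norm_num)).umin ^ 2 / 2) * Real.log 2)) * ((2 * π / Nt)) +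
        (4 * (128 * W * (1 / (qs + 1 / 2)) ^ 2 * (J₀ * (K₁ * (2 * msD A₃ A₄ 1))) *
              (K₂ / ((bandBounds (show (-4 : ℝ) < -1.1 by norm_num) (show (-1.1 : ℝ) ≤ -0.1 by norm_num) (show (-0.1 : ℝ) < 0 by norm_num)).Dtmin - 2 * A)) *
            msD A₃ A₄ 1) /
          (w * (bandBounds (show (-4 : ℝ) < -1.1 by norm_num) (show (-1.1 : ℝ) ≤ -0.1 by norm_num) (show (-0.1 : ℝ) < 0 by norm_num)).umin ^ 2 / 2)) * (2 * (Γ' / ((s₀) / 2)) ^ (1 / 4 : ℝ)) * (8 * Real.sqrt ((2 * π / Nt)))))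
      ((2 * π / Nt) * max (2 * hi * (((4 * (2 * π / J))) * (W * (J₀ * (K₁ * (2 * msD A₃ A₄ 1))) * (4 / d₁ ^ 2))))
        (W * (((J₀ * (K₁ * (2 * msD A₃ A₄ 1))) * ((K₂ * msD A₃ A₄ 1 ^ 2 + K₁ * msD A₃ A₄ 2) / lam ^ 2) + ((24 * msD A₃ A₄ 1 / τ₂ * J₀ * (K₁ * (2 * msD A₃ A₄ 1)) + J₁ * (K₁ * (2 * msD A₃ A₄ 1)) + J₀ * (K₂ * msD A₃ A₄ 1 * (2 * msD A₃ A₄ 1))) + (J₀ * (K₁ * (2 * msD A₃ A₄ 1))) * (6 / (2 * π / J))) * lam⁻¹) * (lam⁻¹ * (4 * Real.sqrt K₀))) * (4 * Real.sqrt hi)))) := by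
  have hADt : 2 * A < (bandBounds (show (-4 : ℝ) < -1.1 by norm_num) (show (-1.1 : ℝ) ≤ -0.1 by norm_num) (show (-0.1 : ℝ) < 0 by norm_num)).Dtmin := by
    have := klCurveD_pos; linarith only [this, hd]
  have hDt : 0 < (bandBounds (show (-4 : ℝ) < -1.1 by norm_num) (show (-1.1 : ℝ) ≤ -0.1 by norm_num) (show (-0.1 : ℝ) < 0 by norm_num)).Dtmin - 2 * A := by linarith only [hADt]
  have hD1 : 0 < msD A₃ A₄ 1 := msD_one_pos A₃ A₄
  have hK₁0 : 0 ≤ K₁ := (norm_nonneg _).trans (hK₁ 0)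
  have hK₂0 : 0 ≤ K₂ := (norm_nonneg _).trans (hK₂ 0)
  have hNt' : (Nt : ℝ) ≠ 0 := by exact_mod_cast hNt.ne'
  -- rows of the two cut-offs (k3c3-p3's `…UmkCutoffDefs`)
  have hcdD : ∀ ϑ, ContDiff ℝ 1 (umkDirCut μ K ρ θ τ₂ ϑ) := fun ϑ => contDiff_umkDirCut hA hd hr hlo hhi ρ θ τ₂ ϑ
  have hcd0 : ∀ ϑ v, 0 ≤ umkDirCut μ K ρ θ τ₂ ϑ v := fun ϑ v => (umkDirCut_mem_Icc μ K ρ θ τ₂ ϑ v).1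
  have hcd1 : ∀ ϑ v, umkDirCut μ K ρ θ τ₂ ϑ v ≤ 1 := fun ϑ v => (umkDirCut_mem_Icc μ K ρ θ τ₂ ϑ v).2
  have hcdd : ∀ ϑ v, |deriv (umkDirCut μ K ρ θ τ₂ ϑ) v| ≤ 24 * msD A₃ A₄ 1 / τ₂ := fun ϑ v => abs_deriv_umkDirCut_le hA hA20 hd hr hlo hhi hA₃ hA₄ hτ₂ ρ θ ϑ v
  have hcd2 : Continuous fun q : ℝ × ℝ => umkDirCut μ K ρ θ τ₂ q.1 q.2 := continuous_umkDirCut₂ hA hd hr hlo hhi hρ θ τ₂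
  have hcc0 : ∀ ϑ, 0 ≤ umkCooperCut μ K ρ θ s₂ ϑ := fun ϑ => (umkCooperCut_mem_Icc μ K ρ θ s₂ ϑ).1
  have hcc1 : ∀ ϑ, umkCooperCut μ K ρ θ s₂ ϑ ≤ 1 := fun ϑ => (umkCooperCut_mem_Icc μ K ρ θ s₂ ϑ).2
  have hcc2 : Continuous (umkCooperCut μ K ρ θ s₂) := continuous_umkCooperCut hA hd hlo hhi hρ θ s₂
  have hU := umkLoopCircle_integral_ppFarSSplit_le_canonical hA hA20 hd hr hlo hhi hA₃ hA₄ hK₁ hK₂ hK₃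
    (Y := fun ϑ e v => umkDirCut μ K ρ θ τ₂ ϑ v * umkCooperCut μ K ρ θ s₂ ϑ * Jw e v * ((fderiv ℝ (frameLevel μ K) (pairSumPath μ K ρ ϑ θ 0 - levelPoint μ K e (v + θ))) (iteratedDeriv 1 (levelPoint μ K 0) θ + iteratedDeriv 1 (levelPoint μ K ρ) (ϑ + θ))))
    (Nt := Nt) (α₀ := 0) (ℓ := 2 * π / Nt) (v₀ := -π) (τ₁ := τ₂ / 2) (s₁ := s₂ / 2)
    (Y₀ := (J₀ * (K₁ * (2 * msD A₃ A₄ 1)))) (Y₁ := (24 * msD A₃ A₄ 1 / τ₂ * J₀ * (K₁ * (2 * msD A₃ A₄ 1)) + J₁ * (K₁ * (2 * msD A₃ A₄ 1)) + J₀ * (K₂ * msD A₃ A₄ 1 * (2 * msD A₃ A₄ 1))))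
    (YL := (JL * (K₁ * (2 * msD A₃ A₄ 1)) + J₀ * (K₂ * (2 * msD A₃ A₄ 1) / ((bandBounds (show (-4 : ℝ) < -1.1 by norm_num) (show (-1.1 : ℝ) ≤ -0.1 by norm_num) (show (-0.1 : ℝ) < 0 by norm_num)).Dtmin - 2 * A))))
    hF hG hρ hρ₀ θ hJ hkβ hkΛ hkB₁ hkB₂ hkB₃ hkt₀ hkt25 hkloΛ hW' hwL (by positivity) hWm hMρ hmod hsl hrt hlo0 hlohi hhir hqs hqs' hW hAfl hBfl hK₀
    hK₀pos hΓ₁ hΓ₂ hΓ'₁ hΔ hΔ1 hΔu hΔr hDfl hwc hw0 hwW hsame hΔc1 hΔcr hω₁ hΓ hhir₀ hhiK hd₁ hlam hhid hepsr hT hτ₀ hκ₀ hκ₀le hs₀ hs₀le hτ₁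
    (fun ϑ _ e _ v h => umkNumerator_null_dir ρ θ (cd := umkDirCut μ K ρ θ τ₂) (cc := umkCooperCut μ K ρ θ s₂) (Jw := Jw) (fun ϑ v h => umkDirCut_eq_zero hτ₂ μ K ρ θ ϑ v h) ϑ e v h)
    hs₁
    (fun ϑ _ e _ v h => umkNumerator_null_cooper ρ θ (cd := umkDirCut μ K ρ θ τ₂) (cc := umkCooperCut μ K ρ θ s₂) (Jw := Jw) (fun ϑ h => umkCooperCut_eq_zero hs₂ μ K ρ θ ϑ h) ϑ e v h)
    hWφ hΓ'₂ hΔc hω₂ heps (by positivity) (by positivity) (by positivity)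
    (fun ϑ e he => umkNumerator_contDiff hA hd hlo hhi ρ θ hhir (cd := umkDirCut μ K ρ θ τ₂) (cc := umkCooperCut μ K ρ θ s₂) (Jw := Jw) hcdD hJwd ϑ he)
    (umkNumerator_continuousOn₃ hA hd hlo hhi hρ θ hhir (cd := umkDirCut μ K ρ θ τ₂) (cc := umkCooperCut μ K ρ θ s₂) (Jw := Jw) hcd2 hcc2 hJw2)
    (fun ϑ e he v => umkNumerator_abs_le hA hA20 hd hlo hhi hA₃ hA₄ hK₁ hρ θ (cd := umkDirCut μ K ρ θ τ₂) (cc := umkCooperCut μ K ρ θ s₂) (Jw := Jw) hcd0 hcd1 hcc0 hcc1 hJwb ϑ he v)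
    (fun ϑ e he v => umkNumerator_abs_deriv_le hA hA20 hd hlo hhi hA₃ hA₄ hK₁ hK₂ hρ θ (cd := umkDirCut μ K ρ θ τ₂) (cc := umkCooperCut μ K ρ θ s₂) (Jw := Jw) hhir hcdD hcd0 hcd1 hcdd hcc0 hcc1 hJwd hJwb hJw1 ϑ he v)
    (fun ϑ e he v => umkNumerator_lipschitz hA hA20 hd hr hlo hhi hA₃ hA₄ hK₁ hK₂ hρ θ (cd := umkDirCut μ K ρ θ τ₂) (cc := umkCooperCut μ K ρ θ s₂) (Jw := Jw) hlo0 hlohi hhir hcd0 hcd1 hcc0 hcc1 hJwb hJwL ϑ he v)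
    (fun ϑ e he v => umkNumerator_periodic ρ θ (cd := umkDirCut μ K ρ θ τ₂) (cc := umkCooperCut μ K ρ θ s₂) (Jw := Jw) (fun ϑ v => umkDirCut_periodic μ K ρ θ τ₂ ϑ v) hJwper ϑ he v)
  have h1 : (0 : ℝ) + (Nt : ℝ) * (2 * π / Nt) = 2 * π := by
    have h : (Nt : ℝ) * (2 * π / Nt) = 2 * π := by field_simp
    rw [h, zero_add]
  have h2 : -π + 2 * π = π := by ring
  rw [h1, h2] at hU
  exact hU

end Sizes

end Summit.HubbardSuperconductivity.HubbardSuperconductivity.Theorems.C4a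

end
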